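import Literature.AnabelianGeometry.SemiGraphs.TemperedCurveOfOpenSubgroup
import Literature.IUT.HodgeArakelov.PlusMinusTowerCoverModelCompletion
import Literature.IUT.HodgeArakelov.StableCurveAgreementOfCoverModel
import Literature.IUT.HodgeTheaters.StableCurveTemperedDataOfSpecialFibre
import Literature.AnabelianGeometry.EtaleTheta.DoubleUnderlineTower
import HarnessLib

/-!
# [IUTchII] Def 2.3 (i) / B15 piece 3: the AGREEMENT between the genuine `±`-tower `ofPiCHat` and the genuine [IUTchI] §2 datum of `X̲_v`

S. Mochizuki, *Inter-universal Teichmüller Theory II*, kurims manuscript (Dec. 2020), §2, Def 2.3 (i) p. 67 («`Π^±_v := Π^tp_{X_v}`,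
`Π̂^±_v := Π̂_{X_v}`» with `X_v` read `X̲_v`, F-L6t19g5-1) and (ii) p. 68; *Inter-universal Teichmüller Theory I* (May 2020), §2 pp. 46–47
(the 𝔛-data `Π^tp_X ↪ Π̂_X`, cusps, `I_x ⊆ Δ^tp_X`), Def 3.1 (e) p. 62 (the common model at `v ∈ 𝕍^bad`); [SemiAnbd] §6 p. 69
[cite: Mochizuki2012, II Def 2.3 (i)(ii) pp.67–68; I §2 pp.46–47, Def 3.1 (e) p.62] [cite: MochizukiSemiAnbd2006, §6 p.69].
abc-iut cell, MERGE-MAP row **B15** «common-model identification at `v ∈ 𝕍^bad`» (plan/L6/MERGE-MAP.md; SHAPES HOME/staging/L6/L6-t7/B15-SHAPES.md),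
PIECE 3 (holder abc-iut-w5-d132 gen 4).  PROOF-ONLY (no `def`, no `instance`, no `structure`); consumes BY NAME abc-iut-L6-t19's B14
`PlusMinusTower.ofPiCHat` (p430122), abc-iut-L6-t7's B15 piece 1 `TemperedCurve.ofOpenSubgroup` (the tempered curve `X̲_v`, the finite étale
covering of `X_v` classified by `Π^tp_{X̲_v} = GtpXu l`), abc-iut-L5's `StableCurveTemperedData.ofSpecialFibre` (the [IUTchI] §2 datum of a
tempered curve with special-fibre data), and this seat's p430970 (`exists_of_isProfiniteCompletion`), p431233 (`exists_embHat_ofPiCHat`,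
`continuous_aug_pmHat_ofPiCHat`), p430433 (`ofCoverModel_aug_ι_inclX`).

* `range_aug_GtpXu_eq_GK`, `finiteIndex_GtpXu_of_doubleUnderline` — `aug(Π^tp_{X̲_v}) = G_K`, `[Π^tp_X : Π^tp_{X̲_v}] = l ≠ 0` (the two inputs
  `ofOpenSubgroup` wants for `H := Π^tp_{X̲_v}`, `K' := K`);
* **`exists_stableCurveAgreement_ofPiCHat_ofSpecialFibre`** — for ANY special-fibre data of `X̲_v` (`d, Sf, h36, Σ ⊆ Σ̂, Π_ℍ, cuspMeetsH`)
  and the printed openness input `hDopen` («`D_y` surjects onto an open subgroup of `G_K`»): ∃ `Cu` (abc-iut-w5-d028's transported cuspidal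
  datum) ∃ `A : StableCurveAgreement (ofPiCHat …) Cu (ofSpecialFibre (ofOpenSubgroup X (GtpXu l) … K …) d Sf …)` with
  `A.eHat ∘ emb = toHat ∘ plainIso` — `eHat : Π̂^±_v ⥲ Π̂_{X̲_v}` the uniqueness isomorphism between the two profinite completions of
  `Π^tp_{X̲_v}` (the closure in `Π_C`, p431233; the closure in `Π_X`, piece 1), augmentations matched by the identity of `G_K`.

HONEST LABEL: GENUINE ON BOTH SIDES modulo the binders in the signature — L02 `hZ` and `hN` (the tower's printed inputs), `hDopen`, and the
special-fibre DATA of `X̲_v` (nobody constructs the dual semi-graph of the special fibre of the [EtTh] model; it stays quantified).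
Nothing of the series is asserted; consistency ≠ endorsement; no side taken on [IUTchIII] Cor 3.12.
-/

noncomputable section


namespace Literature.IUT.HodgeArakelov

open Literature.AnabelianGeometry.EtaleTheta Literature.AnabelianGeometry.SemiGraphs Literature.IUT.HodgeTheaters
open scoped Pointwise

namespace PlusMinusTower

variable {p : ℕ} [Fact p.Prime] {M : MuTwoSetting p} (e : M.CLevelData)
  {E : M.toThetaSetting.EtaleThetaData} {l : ℕ} (C : E.DoubleUnderline l) {N : ℕ+}
  (μ : M.toThetaSetting.CyclotomeMod l N) (hC : M.toThetaSetting.Compat) (hS : M.toThetaSetting.Sec2Hyps)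
  (hl : l.Prime) (hp2 : p ≠ 2) (hpl : p ≠ l) (hζ : ∃ ζ : M.toThetaSetting.K, IsPrimitiveRoot ζ (4 * l))
  {η : (C.thetaEnvData μ hC hS).PiYdd → MuN p N} (hη : η ∈ (C.thetaEnvData μ hC hS).thetaCocycles)
  (hZ : Thm16Sub.KerToZIsCompactlyGenerated M.toThetaSetting) (hN : (C.Huu.subgroupOf (M.GtpXu l)).Normal)
  {P : TopGroup.{0}} (T : TemperedCoverings (BadPlaceSetting.ofUnderline C μ hC hS hl hp2 hpl hζ hη) P)

include C in
/-- `aug(Π^tp_{X̲_v}) = G_K`: the covering `X̲_v → X_v` is geometric (already `Π^tp_{X̲̲_v} ↠ G_K`, abc-iut-L2-t8 `map_aug_Huu`).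
[cite: MochizukiEtTh2009, Prop 2.2 (iii) p.37] -/
theorem range_aug_GtpXu_eq_GK :
    (M.aug.toMonoidHom.comp (M.GtpXu l).subtype).range = M.K.fixingSubgroup := by
  apply le_antisymm
  · rintro _ ⟨y, rfl⟩
    change M.aug (y : M.PiTemp) ∈ M.K.fixingSubgroup
    rw [← M.range_aug]
    exact ⟨(y : M.PiTemp), rfl⟩
  · intro σ hσ
    have hσ' : σ ∈ C.Huu.map M.aug.toMonoidHom := by rw [C.map_aug_Huu]; exact hσ
    obtain ⟨h, hh, rfl⟩ := hσ'
    exact ⟨⟨h, C.Huu_le_GtpXu hh⟩, rfl⟩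

include C in
/-- `[Π^tp_X : Π^tp_{X̲_v}] = l ≠ 0`. [cite: MochizukiEtTh2009, Def 2.1 p.36] -/
theorem finiteIndex_GtpXu_of_doubleUnderline : (M.GtpXu l).FiniteIndex :=
  ⟨by rw [M.toThetaSetting.index_GtpXu l]; exact C.l_ne_zero⟩

/-- **B15 PIECE 3 — [IUTchII] Def 2.3 (i) «`Π̂^±_v := Π̂_{X̲_v}`»: the AGREEMENT between abc-iut-L6-t19's GENUINE `±`-tower of record
`PlusMinusTower.ofPiCHat` and abc-iut-L5's GENUINE [IUTchI] §2 datum `StableCurveTemperedData.ofSpecialFibre` OF THE CURVE `X̲_v` (the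
finite étale covering of `X_v` classified by `Π^tp_{X̲_v} = GtpXu l`, abc-iut-L6-t7's `TemperedCurve.ofOpenSubgroup`), for ANY
special-fibre data of `X̲_v` (binders `d, Sf, h36, Σ ⊆ Σ̂, Π_ℍ, …`) and the printed openness input `hDopen`.**  `eHat : Π̂^±_v ⥲ Π̂_{X̲_v}`
is the uniqueness isomorphism of the profinite completion of `Π^tp_{X̲_v}` (both sides are one: p431233 / `isProfiniteCompletion_toHatOfOpen`),
`eHat ∘ emb = toHat ∘ plainIso`; the cuspidal datum is abc-iut-w5-d028's transported one (cusps of `X̲_v` = `H \ Π^tp_X / D_x` over the cusps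
`x` of `X_v`, `I_y = H ∩ g I_x g⁻¹`).  PROVED via `StableCurveAgreement.exists_of_isProfiniteCompletion` (p430970).
HONEST LABEL: GENUINE on both sides modulo the binders named in the signature (L02 `hZ`, `hN`, `hDopen`, the special-fibre DATA of
`X̲_v`); nothing of the series is asserted; no side taken on [IUTchIII] Cor 3.12. ([IUTchII] Def 2.3 (i)(ii), kurims pp.67–68)
[claim: Mochizuki2012, status: disputed] -/
theorem exists_stableCurveAgreement_ofPiCHat_ofSpecialFibre [(M.GtpXu l).FiniteIndex] [FiniteDimensional ℚ_[p] M.K]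
    (hDopen : ∀ (x : M.toTemperedCurve.Pt) (g : M.toTemperedCurve.PiTemp),
      IsOpen (M.toTemperedCurve.aug '' ((M.toTemperedCurve.decompOfOpenAt (M.GtpXu l) x g).map (M.GtpXu l).subtype :
        Set M.toTemperedCurve.PiTemp)))
    (d : (M.toTemperedCurve.ofOpenSubgroup (M.GtpXu l) (M.toThetaSetting.isOpen_GtpXu l) M.K (range_aug_GtpXu_eq_GK C) hDopen).GroupLevelData)
    (Sf : SpecialFibreData ((M.toTemperedCurve.ofOpenSubgroup (M.GtpXu l) (M.toThetaSetting.isOpen_GtpXu l) M.K (range_aug_GtpXu_eq_GK C) hDopen).toTemperedArithmeticGroup d))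
    (h36 : Sf.Gc.Prop36Hypotheses) (Sigma SigmaHat : Set ℕ) (hsub : Sigma ⊆ SigmaHat) (hne : Sigma.Nonempty)
    (hprime : ∀ q ∈ SigmaHat, q.Prime) (hp : p ∉ Sigma) (TpH : Subgroup Sf.chart.G)
    (HatH : Subgroup (TemperedGraphGroupData.exists_completion_of_prop36 Sf.Gc h36 Sf.chart).choose)
    (hle : TpH.map (TemperedGraphGroupData.exists_completion_of_prop36 Sf.Gc h36 Sf.chart).choose_spec.choose.toMonoidHom ≤ HatH)
    (cuspMeetsH : {x : (M.toTemperedCurve.ofOpenSubgroup (M.GtpXu l) (M.toThetaSetting.isOpen_GtpXu l) M.K (range_aug_GtpXu_eq_GK C) hDopen).Pt // (M.toTemperedCurve.ofOpenSubgroup (M.GtpXu l) (M.toThetaSetting.isOpen_GtpXu l) M.K (range_aug_GtpXu_eq_GK C) hDopen).IsCusp x} → Prop) :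
    ∃ (Cu : CuspidalInertiaData (ofPiCHat e C μ hC hS hl hp2 hpl hζ hη hZ hN T)) (A : StableCurveAgreement (ofPiCHat e C μ hC hS hl hp2 hpl hζ hη hZ hN T) Cu (StableCurveTemperedData.ofSpecialFibre (M.toTemperedCurve.ofOpenSubgroup (M.GtpXu l) (M.toThetaSetting.isOpen_GtpXu l) M.K (range_aug_GtpXu_eq_GK C) hDopen) d Sf h36 Sigma SigmaHat hsub hne hprime hp TpH HatH hle cuspMeetsH)),
      (∀ x : T.Xplain,
        A.eHat ⟨(ofPiCHat e C μ hC hS hl hp2 hpl hζ hη hZ hN T).emb x, (ofPiCHat e C μ hC hS hl hp2 hpl hζ hη hZ hN T).emb_le_pmHat ⟨x, rfl⟩⟩ = (StableCurveTemperedData.ofSpecialFibre (M.toTemperedCurve.ofOpenSubgroup (M.GtpXu l) (M.toThetaSetting.isOpen_GtpXu l) M.K (range_aug_GtpXu_eq_GK C) hDopen) d Sf h36 Sigma SigmaHat hsub hne hprime hp TpH HatH hle cuspMeetsH).ιX (T.plainIso x)) ∧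
      (∀ (Q I : Subgroup (ofPiCHat e C μ hC hS hl hp2 hpl hζ hη hZ hN T).Corhat), Cu.IsCuspidalInertia Q I ↔
        I ≤ Q ∧ ∃ I₀, Cu.IsCuspidalInertia (ofPiCHat e C μ hC hS hl hp2 hpl hζ hη hZ hN T).piPM I₀ ∧ I = I₀ ⊓ Q) := by
  -- (a) tower side: `Π̂^±_v` is a profinite completion of `Π^±_v` through `emb` (p431233)
  obtain ⟨embHat, hembHat, hWc⟩ := exists_embHat_ofPiCHat e C μ hC hS hl hp2 hpl hζ hη hZ hN T
  -- (d) `prHat` of the curve side is continuous (`augHat` is)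
  have hpr : Continuous (StableCurveTemperedData.OfSpecialFibre.augHatGK (M.toTemperedCurve.ofOpenSubgroup (M.GtpXu l) (M.toThetaSetting.isOpen_GtpXu l) M.K (range_aug_GtpXu_eq_GK C) hDopen)) :=
    (M.toTemperedCurve.ofOpenSubgroup (M.GtpXu l) (M.toThetaSetting.isOpen_GtpXu l) M.K (range_aug_GtpXu_eq_GK C) hDopen).augHat.continuous.subtype_mk _
  -- (d) `augGK (plainIso x) = aug (emb x)` in `G_K` (σ := id)
  have hcompat : ∀ x : T.Xplain, (StableCurveTemperedData.ofSpecialFibre (M.toTemperedCurve.ofOpenSubgroup (M.GtpXu l) (M.toThetaSetting.isOpen_GtpXu l) M.K (range_aug_GtpXu_eq_GK C) hDopen) d Sf h36 Sigma SigmaHat hsub hne hprime hp TpH HatH hle cuspMeetsH).prTp (T.plainIso x) = (MonoidHom.id _) ((ofPiCHat e C μ hC hS hl hp2 hpl hζ hη hZ hN T).aug ((ofPiCHat e C μ hC hS hl hp2 hpl hζ hη hZ hN T).emb x)) := by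
    intro x
    apply Subtype.ext
    change M.aug (T.plainIso x).1 = ((ofPiCHat e C μ hC hS hl hp2 hpl hζ hη hZ hN T).aug ((ofPiCHat e C μ hC hS hl hp2 hpl hζ hη hZ hN T).emb x)).1
    exact (ofCoverModel_aug_ι_inclX e C μ hC hS hl hp2 hpl hζ hη e.toPiCHat e.isProfiniteCompletion_toPiCHat
      e.toPiCHat_injective e.piCData.aug.toMonoidHom (fun g => e.piCData_aug_apply g) e.piCData.range_aug hZ hN T
      (T.plainIso x).1).symm
  obtain ⟨Cu, A, hA, hlev⟩ := StableCurveAgreement.exists_of_isProfiniteCompletion (ofPiCHat e C μ hC hS hl hp2 hpl hζ hη hZ hN T) (StableCurveTemperedData.ofSpecialFibre (M.toTemperedCurve.ofOpenSubgroup (M.GtpXu l) (M.toThetaSetting.isOpen_GtpXu l) M.K (range_aug_GtpXu_eq_GK C) hDopen) d Sf h36 Sigma SigmaHat hsub hne hprime hp TpH HatH hle cuspMeetsH)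
    embHat hembHat hWc (M.toTemperedCurve.ofOpenSubgroup (M.GtpXu l) (M.toThetaSetting.isOpen_GtpXu l) M.K (range_aug_GtpXu_eq_GK C) hDopen).toHat (fun _ => rfl) (M.toTemperedCurve.ofOpenSubgroup (M.GtpXu l) (M.toThetaSetting.isOpen_GtpXu l) M.K (range_aug_GtpXu_eq_GK C) hDopen).isProfiniteCompletion_toHat T.plainIso
    (continuous_aug_pmHat_ofPiCHat e C μ hC hS hl hp2 hpl hζ hη hZ hN T) hpr (MonoidHom.id _) continuous_id
    Function.injective_id hcompat
  refine ⟨Cu, A, fun x => ?_, hlev⟩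
  have h2 : embHat x = ⟨(ofPiCHat e C μ hC hS hl hp2 hpl hζ hη hZ hN T).emb x, (ofPiCHat e C μ hC hS hl hp2 hpl hζ hη hZ hN T).emb_le_pmHat ⟨x, rfl⟩⟩ := Subtype.ext (hembHat x)
  have h1 := hA x
  rw [h2] at h1
  exact h1

end PlusMinusTower

end Literature.IUT.HodgeArakelov

end
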